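import Literature.MathematicalPhysics.QuantumFieldTheory.Balaban1983to89.B9Local342OfBlocksXSK
import Literature.MathematicalPhysics.QuantumFieldTheory.Balaban1983to89.B9WalkLettersOps

/-!
# `Balaban1983to89.B9BlockKeyTransferXSK` — T. Bałaban, *Propagators and renormalization transformations for lattice gauge theories. II*, Commun. Math. Phys. **96**
# (1984) 223–250 [Balaban1984PropagatorsII], (2.45)–(2.46) p. 231 + (2.51)–(2.54) pp. 232–233, with *Propagators for lattice gauge theories in a background field*,
# CMP **99** (1985) [Balaban1985BackgroundPropagators], (3.41)–(3.42) p. 397: THE KEY TRANSFER «BLOCK-KEYED ⟹ INDEX-KEYED» FOR BLOCK MAJORANTS ON THE SITE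
# COORDINATE CARRIER — a [4]-(2.51) majorant over the all-blocks geometry `geoBK i` keyed by node00-def-Y's `blkOfSK` (every block its own key) gives the
# majorant over the record's geometry `geo9K i` keyed by the index-bond key `blkSK (sIK bI)`, with the SAME rate and the constant multiplied by
# `N₁·e^{2δ}` (`N₁` = a bound on the number of blocks within block-distance `1`), from the two laws of the index map: 1-faithfulness `d(β(key), Δ) ≤ 1`
# and scale-faithfulness `ℓ(key) = ℓ(Δ)`; and the rows-18 face at dag-n06-d's record `opsWalkY`

statement-level skeleton of published theorems with citation tags; proofs where landed; nothing here is a claim about the Yang–Mills mass gap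

**The print.** [4] p. 231: *"d(x, x′) = d(y, y′) if x ∈ B^j(y), x′ ∈ B^{j′}(y′)"* ((2.45)–(2.46): the distance of two points is read on their BLOCKS); (2.51) p. 232:
*"|(Tλ)(x)| ≤ K(y, y′)|λ| for x ∈ B^j(y), supp λ ⊂ B^{j′}(y′)"*; (2.54) p. 233 (the triangle inequality of `d`); B9 (3.41)–(3.42) p. 397: *"x ∈ Δ(y), y ∈ Λ_j … y, y′ ∈ 𝔅"*.

**Why this file (pub-ymgap, node N06 [B9], rows 18; LOCATED-28, dag-n06-d's answer «(T2a) block ⟹ index»).**  The rows-18 consumers of the N06 certificate read the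
INDEX-keyed record `opsWalkY x …` over `geo9Y x` (`blk = blkSK (sIK bI)`); the all-members (3.42) supply is BLOCK-keyed (PLAN (γ′) tables over `geoBK`, every block its own
key, no section — `B9Local342OfBlocksXSK`).  This file is the transfer between the two keys, in the cheap direction: a vector supported on the index fibre of `y′` lives on
the blocks within block-distance `1` of `β y′` (1-faithfulness), so it splits into at most `N₁` block-supported pieces; each piece is read by the block-keyed majorant, and
the two exponential factors `e^{δ}` ((2.54) twice: support side and evaluation side) and the equality of the scale prefactors (scale-faithfulness) give the index-keyed
majorant with constant `N₁·e^{2δ}·C` and the same rate `δ`: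
* §1 ★★ `hasMajorant_blkSK_of_blkOfSK` (any `T`, weight `len^n`, laws `hβ1 ∕ hlen` in node00-def-Y's `Node00.OpsYBlockPinOfRecord` shapes, count `hN`), and the `Hom` form;
* §2 ★★ `local342_opsWalkY_of_blocks` — THE ROWS-18 FACE: the block-keyed (3.42) tables h0–h3 of the record's cube letters `G′_□ = GsqY … (cubeDomY x □)` (PLAN (γ′) shapes,
  generic in the letter through §1 of `B9Local342OfBlocksXSK`) + the two laws + the count give `Local342 (opsWalkY x b B cfg parS bI) R H (N₁·e^{2δ}·(c_R·B_c)) δ U`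
  — rate KEPT, all factors in the constant, as dag-n06-d asked (I.≈33175).

HONEST SCOPE.  Finite bookkeeping ((2.54) twice + a block count); the block tables are HYPOTHESES; nothing of [B9] Cor. 3.6 asserted; count-neutral; rows 18 NOT thereby
derived; N06 NOT discharged; nothing continuum ∕ OS ∕ mass gap ∕ Clay.  Cell `pub-ymgap` (D-0062), seat `pub-ymgap-dag-n06-c` (gen 22).  Net new unproved facts: 0.
NEW file.
-/

noncomputable section

namespace Literature.MathematicalPhysics.QuantumFieldTheory.Balaban1983to89.B9BlockKeyTransferXSK

open Node00 (SiteY FBondY IBondY CfgY SiteOpY SiteParY UboxY shiftY etaS lapS)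
open Node00.OpsYLocalInverse (GsqY)
open B6Geom246MultiLevelBox (blkOf)
open B6Ineq2142KLevelV1 (β)
open B6KLevelCensusIndexV1 (KIdx)
open B6Cover236MultiLevelBlocks (cubes)
open B6RandomWalk (HasMajorant BlockSupp)
open B6RandomWalkHom (HasMajorantHom)
open B9Thm34Ext (toB6)
open B9GeoNormsKLevelV1 (geo9K)
open B9PinMembersKLevelV1 (MemberY geo9Y)
open B9SectBAllBlocksGeometryY (geoBK geoBY dist_beta geoBK_dist_comm geoBK_dist_triangle geoBK_dist_nonneg)
open B9RWSumsReadsNbr (nbr mem_nbr)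
open B9Eq352DivFormLetters (conj)
open B9Eq352GradLetters (diffLetter)
open B9Thm39ReadingCoords (cR39 cR39_nonneg)
open B9CoReadingCoordsS (XSK blkSK sIK GcoS DcoS DscoS LcoS)
open Node00.OpsYBlockPinOfRecord (blkOfSK)
open B9Local342OfBlocksXSK (hasMajorant_GcoS_of_blocks hasMajorantHom_DcoS_GcoS_of_blocks hasMajorantHom_GcoS_DscoS_of_blocks hasMajorantHom_LcoS_GcoS_of_blocks)
open B9Thm37Whole (Ops Local342)
open B9WalkLettersOps (opsWalkY)
open B9WalkLettersCoordsS (cubeDomY)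

variable {d ℓ : ℕ} {hd : 1 ≤ d + 1} {hL : Odd (ℓ + 1) ∧ 1 < ℓ + 1} {b₀ b₁ : ℝ}
variable {κ : Type}

/-! ## §1 The transfer «block-keyed ⟹ index-keyed» -/

section Transfer

variable (i : KIdx d ℓ hd hL b₀ b₁) [Fintype (geoBK i).Site] [Fintype (geo9K i).Site] (bI : FBondY i → IBondY i)
variable {R₀ : ℝ} {H₀ : Prop}

/-- ★★ **THE KEY TRANSFER «BLOCK ⟹ INDEX»** ([4] (2.51) with (2.45)–(2.46), (2.54)): if `T` on the site coordinate carrier has the block majorant `C·ℓ(s)ⁿ·e^{−δd(s,s′)}` over the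
all-blocks geometry keyed by `Δ(·)` (`blkOfSK`), and the index map `bI` is 1-FAITHFUL (`d(β(blkSK (sIK bI) p), Δ(p)) ≤ 1`) and SCALE-FAITHFUL (`ℓ(blkSK (sIK bI) p) = ℓ(Δ(p))`),
and every block has at most `N₁` blocks within block-distance `1`, then `T` has the index-keyed majorant `N₁·e^{2δ}·C·ℓ(y)ⁿ·e^{−δd(y,y′)}` over the record's geometry keyed by
`blkSK (sIK bI)` — SAME rate. (A vector on the index fibre of `y′` splits into ≤ `N₁` block pieces on the blocks within distance `1` of `β y′`; (2.54) twice.)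
[cite: Balaban1984PropagatorsII, (2.51) p.232, (2.45)–(2.46) p.231, (2.54) p.233; Balaban1985BackgroundPropagators, (3.41)–(3.42) p.397] -/
theorem hasMajorant_blkSK_of_blkOfSK
    (hβ1 : ∀ p : XSK κ i, (geoBK i).dist (β i.hN i.D i.hk (blkSK i (sIK i bI) p)) (blkOfSK κ i p) ≤ 1)
    (hlen : ∀ p : XSK κ i, (geo9K i).len (blkSK i (sIK i bI) p) = (geoBK i).len (blkOfSK κ i p))
    {N₁ : ℝ} (hN : ∀ t : (geoBK i).Site, ((nbr (geoBK i) 1 t).card : ℝ) ≤ N₁)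
    {T : Module.End ℝ (XSK κ i → ℝ)} {C δ : ℝ} (hC : 0 ≤ C) (hδ : 0 ≤ δ) (n : ℕ)
    (h : HasMajorant (g := toB6 (geoBK i) R₀ H₀) (blkOfSK κ i) T (fun s s' => C * (geoBK i).len s ^ n * Real.exp (-(δ * (geoBK i).dist s s')))) :
    HasMajorant (g := toB6 (geo9K i) R₀ H₀) (blkSK i (sIK i bI)) T
      (fun y y' => N₁ * Real.exp (2 * δ) * C * (geo9K i).len y ^ n * Real.exp (-(δ * (geo9K i).dist y y'))) := by
  classical
  intro y' F Bd hF q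
  -- the blocks carrying the index fibre of `y′`
  set S : Finset (geoBK i).Site := nbr (geoBK i) 1 (β i.hN i.D i.hk y') with hS
  -- the block pieces of `F`
  set piece : (geoBK i).Site → XSK κ i → ℝ := fun s' p => if blkOfSK κ i p = s' then F p else 0 with hpiece
  have hFabs : ∀ p, |F p| ≤ Bd := fun p => by
    by_cases hp : blkSK i (sIK i bI) p = y'
    · exact hF.bound p hp
    · rw [hF.off p hp, abs_zero]; exact hF.nonneg
  have hBS : ∀ s', BlockSupp (g := toB6 (geoBK i) R₀ H₀) (blkOfSK κ i) (piece s') s' Bd := fun s' =>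
    ⟨hF.nonneg,
      fun p (hp : blkOfSK κ i p = s') => by
        show |(if blkOfSK κ i p = s' then F p else 0)| ≤ Bd
        rw [if_pos hp]; exact hFabs p,
      fun p (hp : ¬blkOfSK κ i p = s') => by
        show (if blkOfSK κ i p = s' then F p else 0) = 0
        rw [if_neg hp]⟩
  -- `F` is the sum of its pieces over `S`
  have hmemS : ∀ p, F p ≠ 0 → blkOfSK κ i p ∈ S := by
    intro p hp
    have hy : blkSK i (sIK i bI) p = y' := by
      by_contra hne; exact hp (hF.off p hne)
    rw [hS, mem_nbr, geoBK_dist_comm, ← hy]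
    exact hβ1 p
  have hsum : F = ∑ s' ∈ S, piece s' := by
    funext p
    rw [Finset.sum_apply]
    by_cases hp : F p = 0
    · rw [hp]; symm
      exact Finset.sum_eq_zero fun s' _ => by simp only [hpiece, hp, ite_self]
    · rw [Finset.sum_eq_single (blkOfSK κ i p) (fun s' _ hne => by simp only [hpiece, if_neg (Ne.symm hne)])
        (fun hn => absurd (hmemS p hp) hn)]
      simp only [hpiece, if_true]
  -- each piece is read by the block-keyed majorant, with (2.54) twice
  set s : (geoBK i).Site := blkOfSK κ i q with hs
  set y : (geo9K i).Site := blkSK i (sIK i bI) q with hy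
  have hE : 0 ≤ C * (geoBK i).len s ^ n := mul_nonneg hC (pow_nonneg ((B9SectBAllBlocksGeometryY.geoBK_len_pos i s).le) n)
  have hterm : ∀ s' ∈ S, |T (piece s') q| ≤ C * (geo9K i).len y ^ n * (Real.exp (2 * δ) * Real.exp (-(δ * (geo9K i).dist y y'))) * Bd := by
    intro s' hs'
    have h1 := h s' (piece s') Bd (hBS s') q
    have hd1 : (geoBK i).dist s' (β i.hN i.D i.hk y') ≤ 1 := mem_nbr.1 hs'
    have hd2 : (geoBK i).dist (β i.hN i.D i.hk y) s ≤ 1 := hβ1 q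
    -- d(β y, β y′) ≤ d(β y, s) + d(s, s′) + d(s′, β y′) ≤ d(s, s′) + 2
    have htri : (geo9K i).dist y y' ≤ (geoBK i).dist s s' + 2 := by
      rw [dist_beta]
      have t1 := geoBK_dist_triangle i (β i.hN i.D i.hk y) s (β i.hN i.D i.hk y')
      have t2 := geoBK_dist_triangle i s s' (β i.hN i.D i.hk y')
      linarith
    have hexp : Real.exp (-(δ * (geoBK i).dist s s')) ≤ Real.exp (2 * δ) * Real.exp (-(δ * (geo9K i).dist y y')) := by
      rw [← Real.exp_add, Real.exp_le_exp]
      have := mul_le_mul_of_nonneg_left htri hδ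
      linarith
    calc |T (piece s') q| ≤ C * (geoBK i).len s ^ n * Real.exp (-(δ * (geoBK i).dist s s')) * Bd := h1
      _ ≤ C * (geoBK i).len s ^ n * (Real.exp (2 * δ) * Real.exp (-(δ * (geo9K i).dist y y'))) * Bd :=
          mul_le_mul_of_nonneg_right (mul_le_mul_of_nonneg_left hexp hE) hF.nonneg
      _ = C * (geo9K i).len y ^ n * (Real.exp (2 * δ) * Real.exp (-(δ * (geo9K i).dist y y'))) * Bd := by rw [hy, hlen q]
  have hcard : (S.card : ℝ) ≤ N₁ := hN _
  have hA : 0 ≤ C * (geo9K i).len y ^ n * (Real.exp (2 * δ) * Real.exp (-(δ * (geo9K i).dist y y'))) * Bd := by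
    rw [hy, hlen q]
    exact mul_nonneg (mul_nonneg hE (mul_nonneg (Real.exp_nonneg _) (Real.exp_nonneg _))) hF.nonneg
  calc |T F q| = |∑ s' ∈ S, T (piece s') q| := by rw [hsum, map_sum, Finset.sum_apply]
    _ ≤ ∑ s' ∈ S, |T (piece s') q| := Finset.abs_sum_le_sum_abs _ _
    _ ≤ ∑ s' ∈ S, C * (geo9K i).len y ^ n * (Real.exp (2 * δ) * Real.exp (-(δ * (geo9K i).dist y y'))) * Bd := Finset.sum_le_sum hterm
    _ = (S.card : ℝ) * (C * (geo9K i).len y ^ n * (Real.exp (2 * δ) * Real.exp (-(δ * (geo9K i).dist y y'))) * Bd) := by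
        rw [Finset.sum_const, nsmul_eq_mul]
    _ ≤ N₁ * (C * (geo9K i).len y ^ n * (Real.exp (2 * δ) * Real.exp (-(δ * (geo9K i).dist y y'))) * Bd) := mul_le_mul_of_nonneg_right hcard hA
    _ = N₁ * Real.exp (2 * δ) * C * (geo9K i).len y ^ n * Real.exp (-(δ * (geo9K i).dist y y')) * Bd := by ring

/-- ★ the same transfer for the two-block form with equal keys (`HasMajorantHom blk blk = HasMajorant blk`, the shape of `Local342.e1–e3`).
[cite: Balaban1984PropagatorsII, (2.51) p.232, (2.54) p.233; Balaban1985BackgroundPropagators, (3.42) p.397] -/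
theorem hasMajorantHom_blkSK_of_blkOfSK
    (hβ1 : ∀ p : XSK κ i, (geoBK i).dist (β i.hN i.D i.hk (blkSK i (sIK i bI) p)) (blkOfSK κ i p) ≤ 1)
    (hlen : ∀ p : XSK κ i, (geo9K i).len (blkSK i (sIK i bI) p) = (geoBK i).len (blkOfSK κ i p))
    {N₁ : ℝ} (hN : ∀ t : (geoBK i).Site, ((nbr (geoBK i) 1 t).card : ℝ) ≤ N₁)
    {T : Module.End ℝ (XSK κ i → ℝ)} {C δ : ℝ} (hC : 0 ≤ C) (hδ : 0 ≤ δ) (n : ℕ)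
    (h : HasMajorantHom (g := toB6 (geoBK i) R₀ H₀) (blkOfSK κ i) (blkOfSK κ i) T
      (fun s s' => C * (geoBK i).len s ^ n * Real.exp (-(δ * (geoBK i).dist s s')))) :
    HasMajorantHom (g := toB6 (geo9K i) R₀ H₀) (blkSK i (sIK i bI)) (blkSK i (sIK i bI)) T
      (fun y y' => N₁ * Real.exp (2 * δ) * C * (geo9K i).len y ^ n * Real.exp (-(δ * (geo9K i).dist y y'))) :=
  (B6RandomWalkHom.hasMajorantHom_iff _ _ _).2
    (hasMajorant_blkSK_of_blkOfSK i bI hβ1 hlen hN hC hδ n ((B6RandomWalkHom.hasMajorantHom_iff _ _ _).1 h))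

end Transfer

/-! ## §2 The rows-18 face at dag-n06-d's record `opsWalkY` -/

section Record

variable [Fintype κ] {𝔸 : Type} [NormedRing 𝔸] [NormedAlgebra ℂ 𝔸] [CompleteSpace 𝔸] [FiniteDimensional ℝ 𝔸]
variable {Mstar : ℕ} (x : MemberY d ℓ hd hL b₀ b₁ Mstar) [Fintype (geo9Y x).Site] [Fintype (geoBY x).Site] (b : Module.Basis κ ℝ 𝔸)
variable (B : B9.Backgrounds) (cfg : B.Cfg → CfgY 𝔸 x.toKIdx) (parS : SiteParY 𝔸 x.toKIdx) (bI : FBondY x.toKIdx → IBondY x.toKIdx)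
variable {R₀ : ℝ} {H₀ : Prop} {U₁ : B.Cfg}

section KShape

variable {G : B6.Geometry} {X Y : Type}

/-- a block majorant with its kernel rewritten. [folklore] -/
private theorem hasMajorant_congrK {blk : X → G.Site} {T : Module.End ℝ (X → ℝ)} {K K' : G.Site → G.Site → ℝ} (hK : K = K')
    (h : HasMajorant (g := G) blk T K) : HasMajorant (g := G) blk T K' := by
  subst hK; exact h

/-- a two-block majorant with its kernel rewritten. [folklore] -/
private theorem hasMajorantHom_congrK {blkX : X → G.Site} {blkY : Y → G.Site} {T : (X → ℝ) →ₗ[ℝ] (Y → ℝ)} {K K' : G.Site → G.Site → ℝ} (hK : K = K')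
    (h : HasMajorantHom (g := G) blkX blkY T K) : HasMajorantHom (g := G) blkX blkY T K' := by
  subst hK; exact h

end KShape

/-- ★★ **THE ROWS-18 FACE AT THE RECORD, ALL MEMBERS, NO SECTION** — the `Local342` conjunct of the N06 certificate's `h36` from BLOCK-KEYED (3.42) tables: at dag-n06-d's
record `opsWalkY x b B cfg parS bI` (`blk = blkY = blkSK (sIK bI)`, `Gsq U □ = GcoS … (GsqY … parS (cubeDomY x □)) U`, `D ∕ Dstar ∕ Lap = DcoS ∕ DscoS ∕ LcoS`, all `rfl`), the four
block tables h0–h3 of the cube letters over the all-blocks geometry `toB6 (geoBY x) R H` keyed by `Δ(·)` (PLAN (γ′) shapes: `G □ = η²G′_□(U)`, `L = η⁻²Δ_U`, one pair `(B_c, δ)`,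
`0 ≤ B_c`, `0 ≤ δ`), the two laws of `bI` (1-faithful, scale-faithful — node00-def-Y's `dist_beta_blkSK_sIK_bIYOfRecord_le_one` ∕ `len_blkSK_sIK_bIYOfRecord_eq` at the
record's `bI`) and a block count `N₁` give `Local342 (opsWalkY x b B cfg parS bI) R H (N₁·e^{2δ}·(c_R·B_c)) δ U` — rate KEPT, every factor in the constant.
[cite: Balaban1985BackgroundPropagators, Cor. 3.6 p.408 + p.409, (3.42) p.397, (3.87) p.409; Balaban1984PropagatorsII, (2.51) p.232, (2.54) p.233, (2.45)–(2.46) p.231] -/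
theorem local342_opsWalkY_of_blocks
    (hβ1 : ∀ p : XSK κ x.toKIdx, (geoBY x).dist (β x.toKIdx.hN x.toKIdx.D x.toKIdx.hk (blkSK x.toKIdx (sIK x.toKIdx bI) p)) (blkOfSK κ x.toKIdx p) ≤ 1)
    (hlen : ∀ p : XSK κ x.toKIdx, (geo9Y x).len (blkSK x.toKIdx (sIK x.toKIdx bI) p) = (geoBY x).len (blkOfSK κ x.toKIdx p))
    {N₁ : ℝ} (hN : ∀ t : (geoBY x).Site, ((nbr (geoBY x) 1 t).card : ℝ) ≤ N₁)
    {η : ℝ} (hη : η = etaS x.toKIdx) {Uc : Fin (d + 1) → SiteY x.toKIdx → 𝔸ˣ} (hUc : Uc = UboxY x.toKIdx (cfg U₁))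
    (G : ↥(cubes x.toKIdx.D.toDomains) → Module.End ℝ (SiteY x.toKIdx → 𝔸)) (L : Module.End ℝ (SiteY x.toKIdx → 𝔸))
    (hG : ∀ c Λ, G c Λ = (η ^ 2) • GsqY x.toKIdx parS (cubeDomY x c) (cfg U₁) Λ) (hL : ∀ Λ, L Λ = (η ^ 2)⁻¹ • lapS x.toKIdx (cfg U₁) Λ)
    {Bc δ : ℝ} (hBc : 0 ≤ Bc) (hδ : 0 ≤ δ)
    (h0 : ∀ c, HasMajorant (g := toB6 (geoBY x) R₀ H₀) (fun p : SiteY x.toKIdx × κ => blkOf x.toKIdx.D.toDomains p.1) (conj b (G c))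
      (fun s s' => Bc * (geoBY x).len s ^ 2 * Real.exp (-(δ * (geoBY x).dist s s'))))
    (h1 : ∀ c (μ : Fin (d + 1)), HasMajorant (g := toB6 (geoBY x) R₀ H₀) (fun p : SiteY x.toKIdx × κ => blkOf x.toKIdx.D.toDomains p.1)
      (conj b (diffLetter (shiftY x.toKIdx) Uc (((η : ℂ))⁻¹) (Sum.inl μ)) * conj b (G c))
      (fun s s' => Bc * (geoBY x).len s * Real.exp (-(δ * (geoBY x).dist s s'))))
    (h2 : ∀ c (μ : Fin (d + 1)), HasMajorant (g := toB6 (geoBY x) R₀ H₀) (fun p : SiteY x.toKIdx × κ => blkOf x.toKIdx.D.toDomains p.1)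
      (conj b (G c) * conj b (diffLetter (shiftY x.toKIdx) Uc (((η : ℂ))⁻¹) (Sum.inr μ)))
      (fun s s' => Bc * (geoBY x).len s * Real.exp (-(δ * (geoBY x).dist s s'))))
    (h3 : ∀ c, HasMajorant (g := toB6 (geoBY x) R₀ H₀) (fun p : SiteY x.toKIdx × κ => blkOf x.toKIdx.D.toDomains p.1) (conj b L * conj b (G c))
      (fun s s' => Bc * 1 * Real.exp (-(δ * (geoBY x).dist s s')))) :
    Local342 (opsWalkY x b B cfg parS bI) R₀ H₀ (N₁ * Real.exp (2 * δ) * (cR39 b * Bc)) δ U₁ := by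
  letI : Fintype (geoBK x.toKIdx).Site := (inferInstance : Fintype (geoBY x).Site)
  letI : Fintype (geo9K x.toKIdx).Site := (inferInstance : Fintype (geo9Y x).Site)
  have hC : 0 ≤ cR39 b * Bc := mul_nonneg (cR39_nonneg b) hBc
  set O : ↥(cubes x.toKIdx.D.toDomains) → SiteOpY 𝔸 x.toKIdx := fun c => GsqY x.toKIdx parS (cubeDomY x c) with hO
  -- block-keyed entries (T1), kernels reshaped to `C·ℓⁿ·e^{−δd}`
  have e0 : ∀ c, HasMajorant (g := toB6 (geoBK x.toKIdx) R₀ H₀) (blkOfSK κ x.toKIdx) (GcoS x.toKIdx b B cfg (O c) U₁)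
      (fun s s' => cR39 b * Bc * (geoBK x.toKIdx).len s ^ 2 * Real.exp (-(δ * (geoBK x.toKIdx).dist s s'))) := fun c =>
    hasMajorant_congrK (by
        funext s s'
        show cR39 b * (Bc * (geoBK x.toKIdx).len s ^ 2 * Real.exp (-(δ * (geoBK x.toKIdx).dist s s'))) = _
        ring)
      (hasMajorant_GcoS_of_blocks x.toKIdx b B cfg (O c) (R₀ := R₀) (H₀ := H₀) hη (G c) (hG c) (h0 c))
  have e1 : ∀ c, HasMajorantHom (g := toB6 (geoBK x.toKIdx) R₀ H₀) (blkOfSK κ x.toKIdx) (blkOfSK κ x.toKIdx)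
      (DcoS x.toKIdx b B cfg U₁ ∘ₗ GcoS x.toKIdx b B cfg (O c) U₁)
      (fun s s' => cR39 b * Bc * (geoBK x.toKIdx).len s ^ 1 * Real.exp (-(δ * (geoBK x.toKIdx).dist s s'))) := fun c =>
    hasMajorantHom_congrK (by
        funext s s'
        show cR39 b * (Bc * (geoBK x.toKIdx).len s * Real.exp (-(δ * (geoBK x.toKIdx).dist s s'))) = _
        ring)
      (hasMajorantHom_DcoS_GcoS_of_blocks x.toKIdx b B cfg (O c) (R₀ := R₀) (H₀ := H₀) hη hUc (G c) (hG c) (h1 c))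
  have e2 : ∀ c, HasMajorantHom (g := toB6 (geoBK x.toKIdx) R₀ H₀) (blkOfSK κ x.toKIdx) (blkOfSK κ x.toKIdx)
      (GcoS x.toKIdx b B cfg (O c) U₁ ∘ₗ DscoS x.toKIdx b B cfg U₁)
      (fun s s' => cR39 b * Bc * (geoBK x.toKIdx).len s ^ 1 * Real.exp (-(δ * (geoBK x.toKIdx).dist s s'))) := fun c =>
    hasMajorantHom_congrK (by
        funext s s'
        show cR39 b * (Bc * (geoBK x.toKIdx).len s * Real.exp (-(δ * (geoBK x.toKIdx).dist s s'))) = _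
        ring)
      (hasMajorantHom_GcoS_DscoS_of_blocks x.toKIdx b B cfg (O c) (R₀ := R₀) (H₀ := H₀) hη hUc (G c) (hG c) (h2 c))
  have e3 : ∀ c, HasMajorantHom (g := toB6 (geoBK x.toKIdx) R₀ H₀) (blkOfSK κ x.toKIdx) (blkOfSK κ x.toKIdx)
      (LcoS x.toKIdx b B cfg U₁ ∘ₗ GcoS x.toKIdx b B cfg (O c) U₁)
      (fun s s' => cR39 b * Bc * (geoBK x.toKIdx).len s ^ 0 * Real.exp (-(δ * (geoBK x.toKIdx).dist s s'))) := fun c =>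
    hasMajorantHom_congrK (by
        funext s s'
        show cR39 b * (Bc * 1 * Real.exp (-(δ * (geoBK x.toKIdx).dist s s'))) = _
        ring)
      (hasMajorantHom_LcoS_GcoS_of_blocks x.toKIdx b B cfg (O c) (R₀ := R₀) (H₀ := H₀) hη (G c) L (hG c) hL (h3 c))
  -- transfer to the index key (T2a) — the record's pins are `rfl`
  refine ⟨fun c => ?_, fun c => ?_, fun c => ?_, fun c => ?_⟩
  · exact hasMajorant_blkSK_of_blkOfSK x.toKIdx bI (R₀ := R₀) (H₀ := H₀) hβ1 hlen hN hC hδ 2 (e0 c)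
  · exact hasMajorantHom_congrK (funext fun y => funext fun y' => by rw [pow_one]; rfl)
      (hasMajorantHom_blkSK_of_blkOfSK x.toKIdx bI (R₀ := R₀) (H₀ := H₀) hβ1 hlen hN hC hδ 1 (e1 c))
  · exact hasMajorantHom_congrK (funext fun y => funext fun y' => by rw [pow_one]; rfl)
      (hasMajorantHom_blkSK_of_blkOfSK x.toKIdx bI (R₀ := R₀) (H₀ := H₀) hβ1 hlen hN hC hδ 1 (e2 c))
  · exact hasMajorantHom_congrK (funext fun y => funext fun y' => by rw [pow_zero, mul_one]; rfl)
      (hasMajorantHom_blkSK_of_blkOfSK x.toKIdx bI (R₀ := R₀) (H₀ := H₀) hβ1 hlen hN hC hδ 0 (e3 c))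

end Record

end Literature.MathematicalPhysics.QuantumFieldTheory.Balaban1983to89.B9BlockKeyTransferXSK
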